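import Summits.HubbardSuperconductivity.HubbardLadder.Bounds.PairCorrelationEtaLineEuclidTPrime
import Summits.HubbardSuperconductivity.HubbardLadder.Bounds.PairFieldEtaLineEuclid
import Literature.MathematicalPhysics.QuantumLattice.HubbardBondPairDecaySharpTTPrime
import Mathlib.Order.LiminfLimsup
import HarnessLib
import HarnessLib.Audit

/-!
# Hubbard ladder — Bounds: the sharp Koma–Tasaki `η`-line for the PAIR FIELD of the `t–t'`
# Hubbard model (`localPair g`, every form factor `g`, in particular `d_{x²-y²}`),
# machine-checked (bounds.tex Thm 10⁗(t′); pair-field twin of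
# `PairCorrelationEtaLineEuclidTPrime.lean`, `t–t'` twin of `PairFieldEtaLineEuclid.lean`)

HONEST FRAMING (cell pub-hubbard): ladder R1–R4 with certified numbers; no claim on H/H₀. These
are bounds for a MODEL CLASS — the grand-canonical `t–t'` Hubbard model
`hubbardTorusTT' L t t' U - μN` on the square torus `(ℤ/Lℤ)²` (every `L ≥ 1`, all real
`t, t', U, μ`, every `β > 0`; Xu et al. 2024, eq. (1)); no materials claim. Companion text:
`pub-hubbard/paper/bounds.tex` §Theorem 10 (Thm 10⁗ and its `t–t'` clause); tables
`pub-hubbard/pub-hubbard-bounds/BOUNDS.md` (row T8⁹) and `EXTREMISERS.md` §5j.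

## Content

The summit's order parameter is the `d_{x²-y²}` pair field `Δ_d = Σ_x P_x`,
`P_x = localPair dWaveFormFactor L x = Σ_{e∈{0,±e₁,±e₂}} (g e/√2) b_{x,x+e}` with the singlet
bond pairs `b_{uv} = c_{u↑}c_{v↓} - c_{u↓}c_{v↑}`. The Literature file
`HubbardBondPairDecaySharpTTPrime` (this seat) proves Koma–Tasaki's Theorem with note 9 (finite
range: each bond family enters the cost with its own amplitude) and footnote [10] (other pairing
operators) for the `t–t'` model with SHARP ingredients — the printed hopping norm on both bond
graphs (`norm_thermalCorr_bondPair_le_exp_two_graphs`), the FLAT Euclidean truncated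
logarithmic dipole on both bond graphs (`exists_euclidLogDipole_two_graphs_flat`: McBryan–Spencer
coefficients `2π` (nearest-neighbour) and `4π` (diagonal, `|e₁ ± e₂|₂² = 2`), constant on the
unit neighbourhoods of its centres so that a bond pair carries gauge charge exactly `2`), and
`norm_thermalCorr_localPair_ttPrime_le_sharp`: for every `q ≥ 0` with
`f := 4q - 4πβ(|t|+2|t'|)q² ≥ 0`, uniformly in `L`,
`|⟨(P_x)† P_y⟩_{β,L}| ≤ 4(Σ_e |g e/√2|)² K(q) 5^f (dist(x,y)+1)^{-f}`,
`K(q) = exp[2β(|t|(2πq²+76q²+544q⁴e^{2q²}) + |t'|(4πq²+289q²+3402q⁴e^{2q²}))]` — the SAME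
exponent as for the on-site pair (`norm_pairCorr_ttPrime_le_rpow_euclid`) and the transverse
spin (`norm_spinCorr_ttPrime_le_rpow_euclid`) of the `t–t'` model, optimum
`q* = 1/(2πβ(|t|+2|t'|))`, `f* = T/(π(|t|+2|t'|))`. Proved here (ladder nodes):

* `PairFieldEtaLineEuclidTPrime` / `pairFieldEtaLineEuclidTPrime_holds` — torus-uniform form,
  EVERY form factor `g`: `β(|t|+2|t'|) < 4/π` (`T > (π/4)(|t|+2|t'|)`) ⟹ `∃ f > 1/4, C`:
  `|⟨(P_x)† P_y⟩_{β,L}| ≤ C (dist+1)^{-f}` for all `L, x, y`;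
* `PairFieldEtaLineSharpTPrime` / `pairFieldEtaLineSharpTPrime_holds` — thermodynamic-limit
  form, every `g`, `|t|+2|t'| > 0`: for every `ε > 0` and `|z| ≥ R(ε)`,
  `limsup_{L→∞} |⟨(P_0)† P_z⟩_{β,L+1}| ≤ |z|^{-(1-ε)/(πβ(|t|+2|t'|))}`; i.e. the McBryan–Spencer
  exponent `η_pair(T) ≥ T/(π(|t|+2|t'|))` for every finite-range singlet pair field of the
  `t–t'` Hubbard model at every `U`, `μ`;
* `dWavePairField_ttPrime_decay_torus`, `dWavePairField_ttPrime_limsup_le_rpow` — the two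
  statements for the summit's `localPair dWaveFormFactor` verbatim.

Reading (bounds.tex Cor 10.3, `t–t'` clause): for `T > (π/4)(|t|+2|t'|)` — `0.94|t|`,
`1.10|t|`, `1.18|t|`, `1.26|t|` for `t'/t = -0.1, -0.2, -0.25, -0.3` — the `d_{x²-y²}` (and
every other finite-range singlet) pair-field correlation of the 2D `t–t'` Hubbard model decays
faster than the Nelson–Kosterlitz/BKT borderline `r^{-1/4}`, whatever `U` and the filling;
unconditional, machine-checked. NOT claimed: optimality of `1/(πβ(|t|+2|t'|))` within the
method, anything at lower `T`, any LOWER bound on correlations.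

References (keys of `lean/references.bib`): KomaTasakiPRL1992 (Theorem, eqs. (5)–(13), note 9,
footnote [10]); SuSuzuki1998; McBryanSpencer1977; NelsonKosterlitz1977; Scalapino1995 §2;
XuEtAl2024 eq. (1); FriedliVelenikSMLS2017 Thm 9.12.
-/

noncomputable section

namespace Summit.HubbardSuperconductivity.HubbardLadder.Bounds

open Matrix Finset NormedSpace
open Literature.MathematicalPhysics.QuantumLattice Literature.Probability.LatticeModels
  Literature.Barriers.HubbardSuperconductivity
open scoped Matrix.Norms.L2Operator ComplexOrder

/-! ### The explicit sharp power law, restated with `pairFieldWeight` -/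

/-- **The sharp explicit pair-field bound of the `t–t'` model (machine-checked in Literature
`HubbardBondPairDecaySharpTTPrime`), restated with `pairFieldWeight`.** For every form factor
`g`, all real `t, t', U, μ`, `β ≥ 0`, every `q ≥ 0` with `f := 4q - 4πβ(|t|+2|t'|)q² ≥ 0` and
all sites `x, y` of `(ℤ/Lℤ)²`: `|⟨(P_x)† P_y⟩_{β,L}| ≤ A_g K(q) 5^f (dist(x,y)+1)^{-f}`,
uniformly in `L`. -/
theorem norm_pairFieldCorr_ttPrime_le_rpow_euclid (L : ℕ) [NeZero L] (g : Site 2 → ℝ)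
    (t t' U μ β q : ℝ) (hβ : 0 ≤ β) (hq : 0 ≤ q)
    (hf : 0 ≤ 4 * q - 4 * Real.pi * (β * (|t| + 2 * |t'|)) * q ^ 2) (x y : TorusSite 2 L) :
    ‖(hubbardTorusTT' L t t' U - (μ : ℂ) • totalNumber).thermalCorr β
        (localPair g L x)ᴴ (localPair g L y)‖ ≤
      pairFieldWeight g *
        (Real.exp (2 * β * (|t| * (2 * Real.pi * q ^ 2 + 76 * q ^ 2 +
            544 * q ^ 4 * Real.exp (2 * q ^ 2)) +
          |t'| * (4 * Real.pi * q ^ 2 + 289 * q ^ 2 + 3402 * q ^ 4 * Real.exp (2 * q ^ 2)))) *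
        ((5 : ℝ) ^ (4 * q - 4 * Real.pi * (β * (|t| + 2 * |t'|)) * q ^ 2) *
          ((torusDist x y : ℝ) + 1) ^
            (-(4 * q - 4 * Real.pi * (β * (|t| + 2 * |t'|)) * q ^ 2)))) :=
  norm_thermalCorr_localPair_ttPrime_le_sharp L g t t' U μ β q hβ hq hf x y

/-- The a priori bound for the `t–t'` model: `|⟨(P_x)† P_y⟩_{β,L}| ≤ A_g` (`φ = 0`). -/
theorem norm_pairFieldCorr_ttPrime_le_weight (L : ℕ) [NeZero L] (g : Site 2 → ℝ)
    (t t' U μ β : ℝ) (hβ : 0 ≤ β) (x y : TorusSite 2 L) :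
    ‖(hubbardTorusTT' L t t' U - (μ : ℂ) • totalNumber).thermalCorr β
        (localPair g L x)ᴴ (localPair g L y)‖ ≤ pairFieldWeight g :=
  norm_thermalCorr_localPair_ttPrime_le_apriori L g t t' U μ β hβ x y

/-! ### The sharp pair-field `η`-line of the `t–t'` model, torus-uniform form -/

/-- **Cor 10.3 (t′) (torus form, sharp constant, every form factor; PROVED below).**
Grand-canonical `t–t'` Hubbard model `H_{t,t'}(U) - μN` on `(ℤ/Lℤ)²`, any form factor
`g : ℤ² → ℝ` (pair field `P_x = Σ_{e∈{0,±e₁,±e₂}} (g e/√2) b_{x,x+e}`; `g = dWaveFormFactor` is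
the summit's), any real `t, t', U, μ`, `β > 0` with `β(|t|+2|t'|) < 4/π` (temperature
`T > (π/4)(|t|+2|t'|)`; for `t' = -0.2t`: `T > 1.10|t|`): there are `f > 1/4` and `C` with
`|⟨(P_x)† P_y⟩_{β,L}| ≤ C (dist(x,y)+1)^{-f}` for all `L, x, y` — no pair-field
quasi-long-range order with `η ≤ 1/4` there, whatever `U`, `μ`. kind: support (PROVED).
Why it might fail: it cannot (proved); NOT claimed: optimality of the exponent within the
method, any lower bound. Sources: KomaTasakiPRL1992 Theorem, eqs. (5)–(13), note 9,
footnote [10]; SuSuzuki1998; McBryanSpencer1977; NelsonKosterlitz1977; XuEtAl2024 eq. (1); this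
cell bounds.tex Thm 10⁗. -/
@[conjecture] def PairFieldEtaLineEuclidTPrime : Prop :=
  ∀ (g : Site 2 → ℝ) (t t' U μ β : ℝ), 0 < β → β * (|t| + 2 * |t'|) < 4 / Real.pi →
    ∃ f C : ℝ, 1 / 4 < f ∧ ∀ (L : ℕ) [NeZero L] (x y : TorusSite 2 L),
      ‖(hubbardTorusTT' L t t' U - (μ : ℂ) • totalNumber).thermalCorr β
          (localPair g L x)ᴴ (localPair g L y)‖ ≤
        C * ((torusDist x y : ℝ) + 1) ^ (-f)

/-- **`PairFieldEtaLineEuclidTPrime` holds** (with `b = β(|t|+2|t'|)`: witness `q = 1/4` when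
`πb ≤ 2`, `f = 1 - πb/4 ≥ 1/2`; else `q = 1/(2πb)`, `f = 1/(πb) > 1/4`;
`C = A_g K(q) 5^f`, `A_g = pairFieldWeight g`). -/
theorem pairFieldEtaLineEuclidTPrime_holds : PairFieldEtaLineEuclidTPrime := by
  intro g t t' U μ β hβ hb
  set b : ℝ := β * (|t| + 2 * |t'|) with hbdef
  have hb0' : 0 ≤ b := by positivity
  have hπ := Real.pi_pos
  have hb4 : Real.pi * b < 4 := by
    have := (lt_div_iff₀ hπ).1 hb
    linarith
  by_cases hc : Real.pi * b ≤ 2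
  · -- `q = 1/4`
    have hf0 : 0 ≤ 4 * (1 / 4 : ℝ) - 4 * Real.pi * b * (1 / 4 : ℝ) ^ 2 := by nlinarith
    refine ⟨4 * (1 / 4 : ℝ) - 4 * Real.pi * b * (1 / 4 : ℝ) ^ 2,
      pairFieldWeight g *
        (Real.exp (2 * β * (|t| * (2 * Real.pi * (1 / 4 : ℝ) ^ 2 + 76 * (1 / 4 : ℝ) ^ 2 +
            544 * (1 / 4 : ℝ) ^ 4 * Real.exp (2 * (1 / 4 : ℝ) ^ 2)) +
          |t'| * (4 * Real.pi * (1 / 4 : ℝ) ^ 2 + 289 * (1 / 4 : ℝ) ^ 2 +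
            3402 * (1 / 4 : ℝ) ^ 4 * Real.exp (2 * (1 / 4 : ℝ) ^ 2)))) *
          (5 : ℝ) ^ (4 * (1 / 4 : ℝ) - 4 * Real.pi * b * (1 / 4 : ℝ) ^ 2)),
      by nlinarith, fun L _ x y => ?_⟩
    rw [mul_assoc, mul_assoc]
    exact norm_pairFieldCorr_ttPrime_le_rpow_euclid L g t t' U μ β (1 / 4) hβ.le (by norm_num)
      hf0 x y
  · -- `q = q* = 1/(2πb)`
    have hc' : 2 < Real.pi * b := not_le.1 hc
    have hb0 : 0 < b := by
      rcases hb0'.eq_or_lt with h | h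
      · rw [← h, mul_zero] at hc'; linarith
      · exact h
    set q : ℝ := 1 / (2 * Real.pi * b) with hq
    have hq0 : 0 ≤ q := by positivity
    have hfval : 4 * q - 4 * Real.pi * b * q ^ 2 = 1 / (Real.pi * b) := by
      rw [hq]
      field_simp
      ring
    have hf4 : 1 / 4 < 4 * q - 4 * Real.pi * b * q ^ 2 := by
      rw [hfval, div_lt_div_iff₀ (by norm_num) (by positivity)]
      linarith
    refine ⟨4 * q - 4 * Real.pi * b * q ^ 2,
      pairFieldWeight g *
        (Real.exp (2 * β * (|t| * (2 * Real.pi * q ^ 2 + 76 * q ^ 2 +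
            544 * q ^ 4 * Real.exp (2 * q ^ 2)) +
          |t'| * (4 * Real.pi * q ^ 2 + 289 * q ^ 2 + 3402 * q ^ 4 * Real.exp (2 * q ^ 2)))) *
          (5 : ℝ) ^ (4 * q - 4 * Real.pi * b * q ^ 2)), hf4, fun L _ x y => ?_⟩
    rw [mul_assoc, mul_assoc]
    exact norm_pairFieldCorr_ttPrime_le_rpow_euclid L g t t' U μ β q hβ.le hq0 (by linarith) x y

/-! ### The sharp pair-field exponent `η_pair(T) ≥ T/(π(|t|+2|t'|))`, thermodynamic-limit form -/

/-- **Thm 10⁗(t′) (the sharp Koma–Tasaki pair-field decay exponent of the `t–t'` model, every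
form factor; PROVED below).** For every form factor `g`, all real `U, μ`, all `t, t'` with
`|t| + 2|t'| > 0`, `β > 0` and `ε > 0` there is `R` such that for every `z ∈ ℤ²` with `|z| ≥ R`,
`limsup_{L→∞} |⟨(P_0)† P_z⟩_{β,L+1}| ≤ |z|^{-(1-ε)/(πβ(|t|+2|t'|))}` — the pair-field
correlations of the 2D `t–t'` Hubbard model decay at least as fast as `|z|^{-η}` with
`η = T/(π(|t|+2|t'|))` (McBryan–Spencer's exponent for the plane rotator, with Koma–Tasaki's
printed two-graph hopping norm). The hypothesis `|t| + 2|t'| > 0` only excludes the atomic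
limit (junk exponent `0` while the weight may exceed `1`). kind: support (PROVED). Why it might
fail: it cannot (proved); the `limsup` form sidesteps the (unformalised) infinite-volume Gibbs
state exactly as `PairEtaLineSharp` does. Sources: KomaTasakiPRL1992 Theorem, note 9 and
footnote [10]; SuSuzuki1998; McBryanSpencer1977; XuEtAl2024 eq. (1); this cell bounds.tex
Thm 10⁗. -/
@[conjecture] def PairFieldEtaLineSharpTPrime : Prop :=
  ∀ (g : Site 2 → ℝ) (t t' U μ β : ℝ), 0 < |t| + 2 * |t'| → 0 < β → ∀ ε : ℝ, 0 < ε →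
    ∃ R : ℝ, ∀ z : Fin 2 → ℤ, R ≤ intNorm z →
      Filter.limsup (fun L : ℕ =>
          ‖(hubbardTorusTT' (L + 1) t t' U - (μ : ℂ) • totalNumber).thermalCorr β
            (localPair g (L + 1) (torusSiteOfInt (L + 1) 0))ᴴ
            (localPair g (L + 1) (torusSiteOfInt (L + 1) z))‖)
        Filter.atTop ≤ intNorm z ^ (-((1 - ε) / (Real.pi * β * (|t| + 2 * |t'|))))

/-- **`PairFieldEtaLineSharpTPrime` holds**: `norm_thermalCorr_localPair_ttPrime_le_sharp` at
`q* = 1/(2πβ(|t|+2|t'|))` (`f* = 1/(πβ(|t|+2|t'|))`) fed into `exists_limsup_le_rpow` with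
constant `(A_g + 1) K(q*)` and slack `e = ε f*`. -/
theorem pairFieldEtaLineSharpTPrime_holds : PairFieldEtaLineSharpTPrime := by
  intro g t t' U μ β htt hβ ε hε
  set b : ℝ := β * (|t| + 2 * |t'|) with hbdef
  have hb0 : 0 < b := mul_pos hβ htt
  have hπ := Real.pi_pos
  set q : ℝ := 1 / (2 * Real.pi * b) with hq
  have hq0 : 0 ≤ q := by positivity
  set fs : ℝ := 4 * q - 4 * Real.pi * b * q ^ 2 with hfs
  have hfval : fs = 1 / (Real.pi * b) := by
    rw [hfs, hq]
    field_simp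
    ring
  have hfpos : 0 < fs := by rw [hfval]; positivity
  have hεf : 0 < ε * fs := by positivity
  have hA0 : 0 ≤ pairFieldWeight g := pairFieldWeight_nonneg g
  set K : ℝ := Real.exp (2 * β * (|t| * (2 * Real.pi * q ^ 2 + 76 * q ^ 2 +
      544 * q ^ 4 * Real.exp (2 * q ^ 2)) +
    |t'| * (4 * Real.pi * q ^ 2 + 289 * q ^ 2 + 3402 * q ^ 4 * Real.exp (2 * q ^ 2)))) with hK
  have hK0 : 0 < K := Real.exp_pos _
  have hAK : 0 < (pairFieldWeight g + 1) * K := by positivity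
  obtain ⟨R, hR⟩ := exists_limsup_le_rpow
    (fun L z => ‖(hubbardTorusTT' (L + 1) t t' U - (μ : ℂ) • totalNumber).thermalCorr β
        (localPair g (L + 1) (torusSiteOfInt (L + 1) 0))ᴴ
        (localPair g (L + 1) (torusSiteOfInt (L + 1) z))‖)
    ((pairFieldWeight g + 1) * K) fs (ε * fs) hAK hfpos hεf (fun L z => norm_nonneg _)
    (fun L z => by
      have h := norm_pairFieldCorr_ttPrime_le_rpow_euclid (L + 1) g t t' U μ β q hβ.le hq0
        hfpos.le (torusSiteOfInt (L + 1) 0) (torusSiteOfInt (L + 1) z)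
      have hD : 0 ≤ K * ((5 : ℝ) ^ fs *
          ((torusDist (torusSiteOfInt (L + 1) 0) (torusSiteOfInt (L + 1) z) : ℝ) + 1) ^ (-fs)) :=
        by positivity
      calc _ ≤ pairFieldWeight g * (K * ((5 : ℝ) ^ fs *
            ((torusDist (torusSiteOfInt (L + 1) 0) (torusSiteOfInt (L + 1) z) : ℝ) + 1) ^ (-fs))) := h
        _ ≤ (pairFieldWeight g + 1) * (K * ((5 : ℝ) ^ fs *
            ((torusDist (torusSiteOfInt (L + 1) 0) (torusSiteOfInt (L + 1) z) : ℝ) + 1) ^ (-fs))) :=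
          by nlinarith
        _ = _ := by ring)
  refine ⟨R, fun z hz => ?_⟩
  have hexp : -((1 - ε) / (Real.pi * β * (|t| + 2 * |t'|))) = -fs + ε * fs := by
    rw [hfval, hbdef]
    field_simp
    ring
  rw [hexp]
  exact hR z hz

/-! ### The summit's `d_{x²-y²}` pair field, verbatim -/

/-- **The `d_{x²-y²}` pair field of the summit in the `t–t'` model, torus form**: for
`T > (π/4)(|t|+2|t'|)` there are `f > 1/4` and `C` with
`|⟨(P_x)† P_y⟩_{β,L}| ≤ C (dist(x,y)+1)^{-f}` for all `L, x, y`, where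
`P_x = localPair dWaveFormFactor L x`; every `U`, `μ`. -/
theorem dWavePairField_ttPrime_decay_torus (t t' U μ β : ℝ) (hβ : 0 < β)
    (hb : β * (|t| + 2 * |t'|) < 4 / Real.pi) :
    ∃ f C : ℝ, 1 / 4 < f ∧ ∀ (L : ℕ) [NeZero L] (x y : TorusSite 2 L),
      ‖(hubbardTorusTT' L t t' U - (μ : ℂ) • totalNumber).thermalCorr β
          (localPair dWaveFormFactor L x)ᴴ (localPair dWaveFormFactor L y)‖ ≤
        C * ((torusDist x y : ℝ) + 1) ^ (-f) :=
  pairFieldEtaLineEuclidTPrime_holds dWaveFormFactor t t' U μ β hβ hb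

/-- **The `d_{x²-y²}` pair field of the summit in the `t–t'` model, thermodynamic-limit form**:
for `|t| + 2|t'| > 0`, `β > 0`, `ε > 0` and `|z| ≥ R(ε)`,
`limsup_{L→∞} |⟨(P_0)† P_z⟩_{β,L+1}| ≤ |z|^{-(1-ε)T/(π(|t|+2|t'|))}`, `P = localPair dWaveFormFactor`;
every `U`, `μ`. -/
theorem dWavePairField_ttPrime_limsup_le_rpow (t t' U μ β : ℝ) (htt : 0 < |t| + 2 * |t'|)
    (hβ : 0 < β) (ε : ℝ) (hε : 0 < ε) :
    ∃ R : ℝ, ∀ z : Fin 2 → ℤ, R ≤ intNorm z →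
      Filter.limsup (fun L : ℕ =>
          ‖(hubbardTorusTT' (L + 1) t t' U - (μ : ℂ) • totalNumber).thermalCorr β
            (localPair dWaveFormFactor (L + 1) (torusSiteOfInt (L + 1) 0))ᴴ
            (localPair dWaveFormFactor (L + 1) (torusSiteOfInt (L + 1) z))‖)
        Filter.atTop ≤ intNorm z ^ (-((1 - ε) / (Real.pi * β * (|t| + 2 * |t'|)))) :=
  pairFieldEtaLineSharpTPrime_holds dWaveFormFactor t t' U μ β htt hβ ε hε

end Summit.HubbardSuperconductivity.HubbardLadder.Bounds

end
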